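import Literature.NumberTheory.EllipticCurves.ZpExtensionCoeffSelmerStructure
import HarnessLib

/-!
# Transfer of exact families along an ADMISSIBLE SYSTEM of level maps between two towers
# (the tower algebra behind Howard's Lemma 2.2.7 «`H¹_{F_Λ}(K_v, 𝐓/I𝐓) → H¹_{F_𝔭}(K_v, T_𝔭)`»; theorems only)

Topic `NumberTheory/EllipticCurves` (namespace `Literature.NumberTheory.EllipticCurves.Tower`, sequel of the tower algebra of
`ZpExtensionEisensteinSelmerStructure` §1 (D1: `compatibleFamilies`, `saturatedFamilies`, `levelCondition`) and
`ZpExtensionCoeffSelmerStructure` §1 (lit: `exactFamilies`, `exactLevelCondition`)).  Cell `pub/bsd-print-x9`, seat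
`bsd-line-x9-p2` g4: the `cond_le` field («`F ⊗ R′ ≤ F′` at every place», Howard Rem. 1.2.4 (ii)+(iii) / Lemma 2.2.7) of the
ONE `Hom` from the `Λ`-adic source into the Eisenstein DVR setting (STUB A of the shared μ-crux).

Howard, Lemma 2.2.7 [arXiv:1202.6340 Lemma 3.2.7, p. 16 L142–148]: the natural map `H¹(K_v, 𝐓/𝔭𝐓) → H¹(K_v, T_𝔭)` carries
`H¹_{F_Λ}` into `H¹_{F_𝔭}`.  On the cell's TOWER rendering both conditions are read on finite levels: the source condition
at Shapiro level `σ` is the group of `σ`-th components of EXACT families `x = (x_j)_j` (compatible, `x_j` in the core `C_j`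
at every level; lit's `exactLevelCondition`), the target condition at level `k` is the group of `k`-th components of
SATURATED families (D1's `levelCondition`).  The level maps of the `Hom` are NOT level-parallel: `g_{σ,k} : H_σ → H′_k`
exists for every ADMISSIBLE pair `(σ, k)` (`Adm σ k`; for the curve: `k ≤ σ` and `(ω_σ, p^σ) ≤ (q_m, p^k)`), admissibility
is upward closed in `σ`, and the maps satisfy the two TRIANGLES
(T1) `g_{σ+1,k} = g_{σ,k} ∘ red_σ` and (T2) `red′_k ∘ g_{σ,k+1} = g_{σ,k}`.
THIS FILE (pure algebra of abelian-group towers): along such a system an exact family `x` of the source is carried to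
the family `k ↦ g_{σ₀ k, k}(x_{σ₀ k})` of the target (any admissible choice `σ₀`), which is
INDEPENDENT of the choices (`apply_eq_apply_of_mem_compatibleFamilies`), COMPATIBLE (`transfer_mem_compatibleFamilies`),
and in the target cores when the `g_{σ,k}` carry cores to cores (`transfer_mem_exactFamilies`); whence
**`map_exactLevelCondition_le_exactLevelCondition`** / **`…_le_levelCondition`** (`g_{σ,k}` maps the exact level-`σ`
condition into the exact, hence the saturated, level-`k` condition) and the torsion variant
**`map_exactLevelCondition_le_levelCondition_of_forall_nsmul_eq_zero`** (if `p^a` kills every compatible family of the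
target, the image lies in the saturated level condition of ANY cores — the shape met at the places `v ∣ N`).
Theorems only; no named fact, no instance, no notation, no `sorry`.  BSD is not proved by any of this.

References: [Howard2004HeegnerKolyvagin] Rem. 1.2.4 (ii)+(iii), Lemma 2.2.7, §1.6 (arXiv p. 7 L13–27, p. 12 L29–33, p. 16 L142–148);
[SerreGaloisCohomology1997] I §2.2 (cohomology with compact coefficients as a limit).
-/

noncomputable section

universe u v

namespace Literature.NumberTheory.EllipticCurves.Tower

variable {H : ℕ → Type u} [∀ j, AddCommGroup (H j)] (red : ∀ j, H (j + 1) →+ H j)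
  {H' : ℕ → Type v} [∀ j, AddCommGroup (H' j)] (red' : ∀ j, H' (j + 1) →+ H' j)
  (Adm : ℕ → ℕ → Prop) (g : ∀ σ k, Adm σ k → (H σ →+ H' k))
  (hmono : ∀ σ k, Adm σ k → Adm (σ + 1) k)

/-! ## §1 Admissibility is upward closed; going up the source along (T1) -/

include hmono in
/-- Admissibility propagates up the source tower: `Adm σ k → Adm (σ + d) k`.
[cite: Howard2004HeegnerKolyvagin, §1.6 (arXiv p. 12, L29–33: cofinal levels)] -/
theorem adm_add (σ k : ℕ) (h : Adm σ k) : ∀ d : ℕ, Adm (σ + d) k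
  | 0 => h
  | d + 1 => hmono (σ + d) k (adm_add σ k h d)

include hmono in
/-- Admissibility propagates up the source tower: `Adm σ k → σ ≤ τ → Adm τ k`.
[cite: Howard2004HeegnerKolyvagin, §1.6 (arXiv p. 12, L29–33)] -/
theorem adm_of_le {σ τ : ℕ} (k : ℕ) (h : Adm σ k) (hστ : σ ≤ τ) : Adm τ k := by
  obtain ⟨d, rfl⟩ := Nat.exists_eq_add_of_le hστ
  exact adm_add Adm hmono σ k h d

variable (hT1 : ∀ σ k (h : Adm σ k) (h' : Adm (σ + 1) k) (y : H (σ + 1)), g (σ + 1) k h' y = g σ k h (red σ y))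

include hmono hT1 in
/-- **Going up the source along a compatible family** ((T1) iterated): `g_{σ+d,k}(x_{σ+d}) = g_{σ,k}(x_σ)`.
[cite: Howard2004HeegnerKolyvagin, §1.6 (arXiv p. 12, L29–33) and Rem. 1.2.4] -/
theorem apply_add_eq_apply_of_mem_compatibleFamilies {x : ∀ j, H j} (hx : x ∈ compatibleFamilies red) (σ k : ℕ)
    (h : Adm σ k) : ∀ (d : ℕ) (h' : Adm (σ + d) k), g (σ + d) k h' (x (σ + d)) = g σ k h (x σ)
  | 0, _ => rfl
  | d + 1, h' => by
    change g (σ + d + 1) k h' (x (σ + d + 1)) = g σ k h (x σ)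
    rw [hT1 (σ + d) k (adm_add Adm hmono σ k h d) h' (x (σ + d + 1)),
      (mem_compatibleFamilies_iff red x).1 hx (σ + d)]
    exact apply_add_eq_apply_of_mem_compatibleFamilies hx σ k h d _

include hT1 hmono in
/-- Going up the source along a compatible family, `σ ≤ τ` form. [cite: Howard2004HeegnerKolyvagin, §1.6 and Rem. 1.2.4] -/
theorem apply_eq_apply_of_le_of_mem_compatibleFamilies {x : ∀ j, H j} (hx : x ∈ compatibleFamilies red) {σ τ : ℕ}
    (k : ℕ) (hστ : σ ≤ τ) (h : Adm σ k) (h' : Adm τ k) : g τ k h' (x τ) = g σ k h (x σ) := by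
  obtain ⟨d, rfl⟩ := Nat.exists_eq_add_of_le hστ
  exact apply_add_eq_apply_of_mem_compatibleFamilies red Adm g hmono hT1 hx σ k h d h'

include hT1 hmono in
/-- **Independence of the admissible source level**: `g_{σ,k}(x_σ) = g_{σ′,k}(x_{σ′})` for a compatible family `x` and any
two admissible `σ, σ′`. [cite: Howard2004HeegnerKolyvagin, §1.6 (arXiv p. 12, L29–33) and Rem. 1.2.4] -/
theorem apply_eq_apply_of_mem_compatibleFamilies {x : ∀ j, H j} (hx : x ∈ compatibleFamilies red) {σ σ' : ℕ} (k : ℕ)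
    (h : Adm σ k) (h' : Adm σ' k) : g σ k h (x σ) = g σ' k h' (x σ') := by
  rcases le_total σ σ' with hle | hle
  · exact (apply_eq_apply_of_le_of_mem_compatibleFamilies red Adm g hmono hT1 hx k hle h h').symm
  · exact apply_eq_apply_of_le_of_mem_compatibleFamilies red Adm g hmono hT1 hx k hle h' h

/-! ## §2 The transferred family and its compatibility along (T2) -/

variable (hT2 : ∀ σ k (h : Adm σ (k + 1)) (h' : Adm σ k) (y : H σ), red' k (g σ (k + 1) h y) = g σ k h' y)

include hmono hT1 in
/-- The transferred family does not depend on the admissible choice: its `k`-th component is `g_{σ,k}(x_σ)` for ANY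
admissible `σ`. [cite: Howard2004HeegnerKolyvagin, §1.6 and Rem. 1.2.4] -/
theorem transfer_apply_eq (σ₀ : ℕ → ℕ) (hσ₀ : ∀ k, Adm (σ₀ k) k) {x : ∀ j, H j} (hx : x ∈ compatibleFamilies red)
    {σ : ℕ} (k : ℕ) (h : Adm σ k) : g (σ₀ k) k (hσ₀ k) (x (σ₀ k)) = g σ k h (x σ) :=
  apply_eq_apply_of_mem_compatibleFamilies red Adm g hmono hT1 hx k (hσ₀ k) h

include hmono hT1 hT2 in
/-- **The transferred family is COMPATIBLE** ((T2) at a common admissible level for `k` and `k+1`).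
[cite: Howard2004HeegnerKolyvagin, Rem. 1.2.4 (iii) and §1.6 (arXiv p. 7 L19–27, p. 12 L29–33)] -/
theorem transfer_mem_compatibleFamilies (σ₀ : ℕ → ℕ) (hσ₀ : ∀ k, Adm (σ₀ k) k) {x : ∀ j, H j}
    (hx : x ∈ compatibleFamilies red) : (fun k ↦ g (σ₀ k) k (hσ₀ k) (x (σ₀ k))) ∈ compatibleFamilies red' := by
  rw [mem_compatibleFamilies_iff]
  intro k
  -- a common admissible source level for `k` and `k + 1`
  have h1 : Adm (max (σ₀ k) (σ₀ (k + 1))) (k + 1) := adm_of_le Adm hmono (k + 1) (hσ₀ (k + 1)) (le_max_right _ _)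
  have h0 : Adm (max (σ₀ k) (σ₀ (k + 1))) k := adm_of_le Adm hmono k (hσ₀ k) (le_max_left _ _)
  rw [transfer_apply_eq red Adm g hmono hT1 σ₀ hσ₀ hx (k + 1) h1, transfer_apply_eq red Adm g hmono hT1 σ₀ hσ₀ hx k h0]
  exact hT2 _ k h1 h0 (x _)

include hmono hT1 hT2 in
/-- **The transferred family of an EXACT family lies in the target cores** when the level maps carry cores to cores.
[cite: Howard2004HeegnerKolyvagin, Lemma 2.2.7 (arXiv Lemma 3.2.7, p. 16 L142–148)] -/
theorem transfer_mem_exactFamilies (σ₀ : ℕ → ℕ) (hσ₀ : ∀ k, Adm (σ₀ k) k) (C : ∀ j, AddSubgroup (H j))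
    (C' : ∀ k, AddSubgroup (H' k)) (hC : ∀ σ k (h : Adm σ k), ∀ y ∈ C σ, g σ k h y ∈ C' k) {x : ∀ j, H j}
    (hx : x ∈ exactFamilies red C) : (fun k ↦ g (σ₀ k) k (hσ₀ k) (x (σ₀ k))) ∈ exactFamilies red' C' := by
  rw [mem_exactFamilies_iff] at hx ⊢
  refine ⟨(mem_compatibleFamilies_iff red' _).1
    (transfer_mem_compatibleFamilies red red' Adm g hmono hT1 hT2 σ₀ hσ₀ ((mem_compatibleFamilies_iff red x).2 hx.1)),
    fun k ↦ ?_⟩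
  exact hC _ k (hσ₀ k) _ (hx.2 _)

/-! ## §3 The level maps carry the exact level conditions into the (exact, saturated) level conditions -/

include hmono hT1 hT2 in
/-- **`g_{σ,k}` maps the exact level-`σ` condition of the source into the exact level-`k` condition of the target**
(cores to cores levelwise; some admissible choice `σ₀` exists).
[cite: Howard2004HeegnerKolyvagin, Rem. 1.2.4 (ii)+(iii) and Lemma 2.2.7 (arXiv p. 7 L13–27, p. 16 L142–148)] -/
theorem map_exactLevelCondition_le_exactLevelCondition (σ₀ : ℕ → ℕ) (hσ₀ : ∀ k, Adm (σ₀ k) k)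
    (C : ∀ j, AddSubgroup (H j)) (C' : ∀ k, AddSubgroup (H' k))
    (hC : ∀ σ k (h : Adm σ k), ∀ y ∈ C σ, g σ k h y ∈ C' k) {σ : ℕ} (k : ℕ) (h : Adm σ k) :
    (exactLevelCondition red C σ).map (g σ k h) ≤ exactLevelCondition red' C' k := by
  rintro _ ⟨y, hy, rfl⟩
  obtain ⟨x, hx, rfl⟩ := (mem_exactLevelCondition_iff red C σ y).1 hy
  have hxc : x ∈ compatibleFamilies red := exactFamilies_le_compatibleFamilies red C hx
  rw [← transfer_apply_eq red Adm g hmono hT1 σ₀ hσ₀ hxc k h]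
  exact apply_mem_exactLevelCondition red' C' (transfer_mem_exactFamilies red red' Adm g hmono hT1 hT2 σ₀ hσ₀ C C' hC hx) k

include hmono hT1 hT2 in
/-- **… hence into the SATURATED level-`k` condition of the target** (D1's `levelCondition`, any `p`).
[cite: Howard2004HeegnerKolyvagin, Rem. 1.2.4 (ii)+(iii) and Lemma 2.2.7 (arXiv p. 7 L13–27, p. 16 L142–148)] -/
theorem map_exactLevelCondition_le_levelCondition (σ₀ : ℕ → ℕ) (hσ₀ : ∀ k, Adm (σ₀ k) k) (p : ℕ)
    (C : ∀ j, AddSubgroup (H j)) (C' : ∀ k, AddSubgroup (H' k))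
    (hC : ∀ σ k (h : Adm σ k), ∀ y ∈ C σ, g σ k h y ∈ C' k) {σ : ℕ} (k : ℕ) (h : Adm σ k) :
    (exactLevelCondition red C σ).map (g σ k h) ≤ levelCondition red' p C' k :=
  (map_exactLevelCondition_le_exactLevelCondition red red' Adm g hmono hT1 hT2 σ₀ hσ₀ C C' hC k h).trans
    (exactLevelCondition_le_levelCondition red' p C' k)

include hmono hT1 hT2 in
/-- **Torsion variant** (the places `v ∣ N`): if `p^a` kills every compatible family of the target tower, then `g_{σ,k}`
maps the exact level-`σ` condition of the source for ANY cores into the saturated level-`k` condition of the target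
for ANY cores (`p^a · (transfer x) = 0` lies in every core). [cite: Howard2004HeegnerKolyvagin, Def. 2.1.1 (propagation from V: saturation) and Lemma 2.2.7 (arXiv p. 5, p. 16)] -/
theorem map_exactLevelCondition_le_levelCondition_of_forall_nsmul_eq_zero (σ₀ : ℕ → ℕ) (hσ₀ : ∀ k, Adm (σ₀ k) k)
    (p : ℕ) (a : ℕ) (hkill : ∀ y ∈ compatibleFamilies red', ∀ j, p ^ a • y j = 0)
    (C : ∀ j, AddSubgroup (H j)) (C' : ∀ k, AddSubgroup (H' k)) {σ : ℕ} (k : ℕ) (h : Adm σ k) :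
    (exactLevelCondition red C σ).map (g σ k h) ≤ levelCondition red' p C' k := by
  rintro _ ⟨y, hy, rfl⟩
  obtain ⟨x, hx, rfl⟩ := (mem_exactLevelCondition_iff red C σ y).1 hy
  have hxc : x ∈ compatibleFamilies red := exactFamilies_le_compatibleFamilies red C hx
  have hyc := transfer_mem_compatibleFamilies red red' Adm g hmono hT1 hT2 σ₀ hσ₀ hxc
  rw [← transfer_apply_eq red Adm g hmono hT1 σ₀ hσ₀ hxc k h]
  refine apply_mem_levelCondition red' p C' ((mem_saturatedFamilies_iff red' p C' _).2
    ⟨(mem_compatibleFamilies_iff red' _).1 hyc, a, fun j ↦ ?_⟩) k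
  rw [hkill _ hyc j]
  exact AddSubgroup.zero_mem _

end Literature.NumberTheory.EllipticCurves.Tower

end
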